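import Literature.Analysis.FluidPDE.StationaryEulerIteration
import Literature.Analysis.FunctionSpaces.TorusVectorParseval
import HarnessLib

/-!
# The limit of the iteration (Choffrut–Székelyhidi 2014, §2, Step 3 and Lemma 2)

Topic `Literature/Analysis/FluidPDE`. Support file of the proof of
`Literature.Analysis.FluidPDE.Torus.ChoffrutSzekelyhidi2014_thm1` (Choffrut–Székelyhidi, SIAM
J. Math. Anal. 46 (2014) = arXiv:1401.4301). Along an `L²`-fast subsequence the states of
`StationaryEuler.IterData` converge a.e. to a bounded limit `w = (v, u)` with

* `w(x) ∈ 𝒦_{e(x)}` a.e. (closedness of `𝒦^{co}_r`, vanishing of the defect in the limit and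
  "the useful consequence of (2.5)": `|v|² = e` on `𝒦^{co}_e` forces `𝒦_e`), i.e.
  `u = v ⊗ v - e/d Id` and `|v|² = e` a.e.;
* the weak subsolution identities pass to the limit (dominated convergence);
* `‖v - v₀‖_{H⁻¹} ≤ θ`.

This is the analytic content of the last paragraph of Step 3 of §2 (continuity points of the
Baire-1 map lie in `𝒦_{e(x)}` a.e.), run along the explicit iteration.

## References

* A. Choffrut, L. Székelyhidi Jr., SIAM J. Math. Anal. 46 (2014), §2, Step 3, Lemma 2.
-/

noncomputable section

open scoped InnerProductSpace ContDiff ENNReal Topology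
open Set Function MeasureTheory Metric Filter
open Literature.Analysis.FunctionSpaces

namespace Literature.Analysis.FluidPDE

namespace StationaryEuler

variable {d : Type*} [Fintype d] [DecidableEq d] [Nonempty d]

namespace IterData

variable (D : IterData d)

/-! ## An `L²`-fast subsequence -/

/-- Thresholds of the Cauchy property at level `4^{-i}`. [folklore] -/
def thr (i : ℕ) : ℕ := Classical.choose (D.cauchy (η := (1 / 4) ^ i) (by positivity))

/-- The defining property of the thresholds. [folklore] -/
theorem thr_spec (i : ℕ) : ∀ n m, D.thr i ≤ n → n ≤ m → ∫ x, ‖D.state m x - D.state n x‖ ^ 2 < (1 / 4) ^ i :=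
  Classical.choose_spec (D.cauchy (η := (1 / 4) ^ i) (by positivity))

/-- The subsequence: strictly increasing and above the thresholds. [folklore] -/
def sub : ℕ → ℕ
  | 0 => D.thr 0
  | i + 1 => max (sub i + 1) (D.thr (i + 1))

/-- The subsequence dominates the thresholds. [folklore] -/
theorem thr_le_sub (i : ℕ) : D.thr i ≤ D.sub i := by
  cases i with
  | zero => exact le_rfl
  | succ i => exact le_max_right _ _

/-- The subsequence is strictly increasing. [folklore] -/
theorem sub_lt_sub_succ (i : ℕ) : D.sub i < D.sub (i + 1) :=
  Nat.lt_of_lt_of_le (Nat.lt_succ_self _) (le_max_left _ _)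

/-- The subsequence is strictly monotone. [folklore] -/
theorem sub_strictMono : StrictMono D.sub := strictMono_nat_of_lt_succ D.sub_lt_sub_succ

/-- Fast `L²` convergence along the subsequence: `‖w_{φ(j)} - w_{φ(i)}‖² < 4^{-i}` for `i ≤ j`. [folklore] -/
theorem integral_sq_sub_lt {i j : ℕ} (hij : i ≤ j) :
    ∫ x, ‖D.state (D.sub j) x - D.state (D.sub i) x‖ ^ 2 < (1 / 4) ^ i :=
  D.thr_spec i _ _ (D.thr_le_sub i) (D.sub_strictMono.monotone hij)

/-- `L¹` control of consecutive terms: `∫ ‖w_{φ(i+1)} - w_{φ(i)}‖ ≤ 2^{-i}` (from `L²` via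
`|x| ≤ (t x² + t⁻¹)/2` with `t = 2^i` on the probability space). [folklore] -/
theorem integral_norm_sub_le (i : ℕ) :
    ∫ x, ‖D.state (D.sub (i + 1)) x - D.state (D.sub i) x‖ ≤ (1 / 2) ^ i := by
  set G : UnitAddTorus d → State d := fun x => D.state (D.sub (i + 1)) x - D.state (D.sub i) x with hG
  have hGc : Continuous G := (D.state_continuous _).sub (D.state_continuous _)
  have ht : (0 : ℝ) < 2 ^ i := by positivity
  have hpt : ∀ x, ‖G x‖ ≤ (2 ^ i * ‖G x‖ ^ 2 + (2 ^ i)⁻¹) / 2 := fun x => by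
    have h := sq_nonneg (2 ^ i * ‖G x‖ - 1)
    have h2 : (2 : ℝ) ^ i * (2 ^ i)⁻¹ = 1 := mul_inv_cancel₀ ht.ne'
    nlinarith [norm_nonneg (G x), h2, inv_pos.2 ht]
  have hI2 : Integrable fun x => ‖G x‖ ^ 2 := (hGc.norm.pow 2).integrable_unitAddTorus
  calc ∫ x, ‖G x‖ ≤ ∫ x, (2 ^ i * ‖G x‖ ^ 2 + (2 ^ i)⁻¹) / 2 :=
        integral_mono hGc.norm.integrable_unitAddTorus (((hI2.const_mul _).add (integrable_const _)).div_const _) hpt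
    _ = (2 ^ i * (∫ x, ‖G x‖ ^ 2) + (2 ^ i)⁻¹) / 2 := by
        rw [integral_div, integral_add (hI2.const_mul _) (integrable_const _), integral_const_mul]
        simp
    _ ≤ (2 ^ i * (1 / 4) ^ i + (2 ^ i)⁻¹) / 2 := by
        have h := (D.integral_sq_sub_lt (Nat.le_succ i)).le
        have h' : (∫ x, ‖G x‖ ^ 2) ≤ (1 / 4) ^ i := h
        gcongr
    _ = (1 / 2) ^ i := by
        have h1 : (2 : ℝ) ^ i * (1 / 4) ^ i = (1 / 2) ^ i := by rw [← mul_pow]; norm_num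
        have h2 : ((2 : ℝ) ^ i)⁻¹ = (1 / 2) ^ i := by rw [← inv_pow]; norm_num
        rw [h1, h2]; ring

/-! ## Almost everywhere convergence -/

/-- **Almost everywhere convergence along the subsequence** (summable `L¹` increments).
[folklore] -/
theorem ae_exists_tendsto : ∀ᵐ x, ∃ l : State d, Tendsto (fun i => D.state (D.sub i) x) atTop (𝓝 l) := by
  set G : ℕ → UnitAddTorus d → State d := fun i x => D.state (D.sub i) x with hG
  have hGc : ∀ i, Continuous (G i) := fun i => D.state_continuous _
  have hmeas : ∀ i, AEMeasurable (fun x => ‖G (i + 1) x - G i x‖ₑ) volume := fun i =>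
    (((hGc (i + 1)).sub (hGc i)).measurable.enorm).aemeasurable
  have h1 : ∫⁻ x, ∑' i, ‖G (i + 1) x - G i x‖ₑ = ∑' i, ∫⁻ x, ‖G (i + 1) x - G i x‖ₑ := lintegral_tsum hmeas
  have h2 : ∀ i, ∫⁻ x, ‖G (i + 1) x - G i x‖ₑ ≤ ENNReal.ofReal ((1 / 2) ^ i) := by
    intro i
    have hint : Integrable (fun x => G (i + 1) x - G i x) := ((hGc (i + 1)).sub (hGc i)).integrable_unitAddTorus
    rw [← ofReal_integral_norm_eq_lintegral_enorm hint]
    exact ENNReal.ofReal_le_ofReal (D.integral_norm_sub_le i)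
  have hgeo : Summable fun i : ℕ => ((1 : ℝ) / 2) ^ i := summable_geometric_of_lt_one (by norm_num) (by norm_num)
  have h3 : ∫⁻ x, ∑' i, ‖G (i + 1) x - G i x‖ₑ < ⊤ := by
    rw [h1]
    calc ∑' i, ∫⁻ x, ‖G (i + 1) x - G i x‖ₑ ≤ ∑' i, ENNReal.ofReal ((1 / 2) ^ i) := ENNReal.tsum_le_tsum h2
      _ = ENNReal.ofReal (∑' i, ((1 : ℝ) / 2) ^ i) := (ENNReal.ofReal_tsum_of_nonneg (fun i => by positivity) hgeo).symm
      _ < ⊤ := ENNReal.ofReal_lt_top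
  have hmeas' : Measurable fun x => ∑' i, ‖G (i + 1) x - G i x‖ₑ := by
    simp_rw [ENNReal.tsum_eq_iSup_sum]
    exact .iSup fun s => s.measurable_fun_sum fun i _ => ((hGc (i + 1)).sub (hGc i)).measurable.enorm
  have h4 : ∀ᵐ x, ∑' i, ‖G (i + 1) x - G i x‖ₑ < ⊤ := ae_lt_top hmeas' h3.ne
  filter_upwards [h4] with x hx
  have hsum : Summable fun i => G (i + 1) x - G i x := .of_nnnorm <| ENNReal.tsum_coe_ne_top_iff_summable.mp hx.ne
  have hx_sum := hsum.hasSum.tendsto_sum_nat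
  rw [funext fun n => Finset.sum_range_sub (fun m => G m x) n] at hx_sum
  exact ⟨∑' i, (G (i + 1) x - G i x) + G 0 x, by simpa using hx_sum.add_const (G 0 x)⟩

/-- **The limit state** `w = lim w_{φ(i)}` (a.e.; junk elsewhere). [cite: ChoffrutSzekelyhidi2014, §2, Step 3] -/
def wlim (x : UnitAddTorus d) : State d := limUnder atTop fun i => D.state (D.sub i) x

/-- The states converge to the limit state a.e. [folklore] -/
theorem ae_tendsto_wlim : ∀ᵐ x, Tendsto (fun i => D.state (D.sub i) x) atTop (𝓝 (D.wlim x)) := by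
  filter_upwards [D.ae_exists_tendsto] with x hx
  exact tendsto_nhds_limUnder hx

/-- The limit state is a.e.-strongly measurable. [folklore] -/
theorem aestronglyMeasurable_wlim : AEStronglyMeasurable D.wlim volume :=
  aestronglyMeasurable_of_tendsto_ae atTop (fun i => (D.state_continuous (D.sub i)).aestronglyMeasurable) D.ae_tendsto_wlim

/-- **The limit is bounded by `R`** a.e. [folklore] -/
theorem ae_norm_wlim_le : ∀ᵐ x, ‖D.wlim x‖ ≤ D.R := by
  filter_upwards [D.ae_tendsto_wlim] with x hx
  exact isClosed_Iic.mem_of_tendsto ((continuous_norm.tendsto _).comp hx) (Eventually.of_forall fun i => D.norm_state_le _ x)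

/-- **The limit takes values in `𝒦^{co}_{e(x)}`** a.e. (closedness). [cite: ChoffrutSzekelyhidi2014, §2, Step 3] -/
theorem ae_wlim_mem_C : ∀ᵐ x, D.wlim x ∈ C (D.e x) := by
  filter_upwards [D.ae_tendsto_wlim] with x hx
  have h := isClosed_setOf_mem_C (d := d) |>.mem_of_tendsto ((tendsto_const_nhds (x := D.e x)).prodMk_nhds hx)
    (Eventually.of_forall fun i => (D.state_memX0 (D.sub i)).mem_C x)
  exact h

/-- The limit is admissible a.e. [folklore] -/
theorem ae_isAdm_wlim : ∀ᵐ x, IsAdm (D.wlim x) := by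
  filter_upwards [D.ae_wlim_mem_C] with x hx using hx.1

/-! ## The defect vanishes in the limit -/

/-- **`|v|² = e` a.e. for the limit**: the defects `J(w_{φ(i)}) → 0` and dominated convergence.
[cite: ChoffrutSzekelyhidi2014, §2, Step 3] -/
theorem ae_norm_vel_wlim_sq : ∀ᵐ x, ‖vel (D.wlim x)‖ ^ 2 = D.e x := by
  set g : ℕ → UnitAddTorus d → ℝ := fun i x => D.e x - ‖vel (D.state (D.sub i) x)‖ ^ 2 with hg
  set gl : UnitAddTorus d → ℝ := fun x => D.e x - ‖vel (D.wlim x)‖ ^ 2 with hgl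
  have hgc : ∀ i, Continuous (g i) := fun i =>
    D.he.sub ((continuous_norm.comp (continuous_vel.comp (D.state_continuous _))).pow 2)
  -- dominated convergence: `∫ g i → ∫ gl`
  have hbound : ∀ i, ∀ᵐ x, ‖g i x‖ ≤ D.ebar + D.R ^ 2 := fun i => Eventually.of_forall fun x => by
    rw [Real.norm_eq_abs, abs_le]
    have h1 := (D.state_memX0 (D.sub i)).norm_vel_sq_le x
    have h2 := (D.state_memX0 (D.sub i)).nonneg x
    have h3 := D.e_le_ebar x
    have h4 : ‖vel (D.state (D.sub i) x)‖ ^ 2 ≤ D.R ^ 2 :=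
      pow_le_pow_left₀ (norm_nonneg _) ((norm_vel_le _).trans (D.norm_state_le _ x)) 2
    constructor <;> simp only [hg] <;> nlinarith [sq_nonneg D.R]
  have hlim : ∀ᵐ x, Tendsto (fun i => g i x) atTop (𝓝 (gl x)) := by
    filter_upwards [D.ae_tendsto_wlim] with x hx
    exact tendsto_const_nhds.sub (((continuous_norm.comp continuous_vel).tendsto _).comp hx |>.pow 2)
  have hT := tendsto_integral_of_dominated_convergence (fun _ => D.ebar + D.R ^ 2)
    (fun i => (hgc i).aestronglyMeasurable) (integrable_const _) hbound hlim
  -- but `∫ g i = J (φ i) → 0`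
  have hJ : Tendsto (fun i => ∫ x, g i x) atTop (𝓝 0) := by
    have := D.tendsto_J.comp D.sub_strictMono.tendsto_atTop
    exact this
  have h0 : ∫ x, gl x = 0 := tendsto_nhds_unique hT hJ
  -- `gl ≥ 0` a.e. and integrable
  have hgl0 : 0 ≤ᵐ[volume] gl := by
    filter_upwards [D.ae_wlim_mem_C] with x hx
    exact sub_nonneg.2 (norm_vel_sq_le_of_mem_C hx)
  have hgli : Integrable gl := by
    refine Integrable.mono' (integrable_const (D.ebar + D.R ^ 2)) ?_ ?_
    · exact aestronglyMeasurable_of_tendsto_ae atTop (fun i => (hgc i).aestronglyMeasurable) hlim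
    · filter_upwards [D.ae_norm_wlim_le, D.ae_wlim_mem_C] with x hx hC
      rw [Real.norm_eq_abs, abs_le]
      have h1 := norm_vel_sq_le_of_mem_C hC
      have h2 := nonneg_of_mem_C hC
      have h3 := D.e_le_ebar x
      have h4 : ‖vel (D.wlim x)‖ ^ 2 ≤ D.R ^ 2 := pow_le_pow_left₀ (norm_nonneg _) ((norm_vel_le _).trans hx) 2
      constructor <;> simp only [hgl] <;> nlinarith [sq_nonneg D.R]
  have hae := (integral_eq_zero_iff_of_nonneg_ae hgl0 hgli).1 h0
  filter_upwards [hae] with x hx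
  simp only [hgl, Pi.zero_apply] at hx
  linarith

/-- **The limit lies in `𝒦_{e(x)}` a.e.**: `u = v ⊗ v - e/d Id`, `|v|² = e`.
[cite: ChoffrutSzekelyhidi2014, §2, Step 3 and (2.6)] -/
theorem ae_wlim_mem_K : ∀ᵐ x, D.wlim x ∈ K (D.e x) := by
  filter_upwards [D.ae_wlim_mem_C, D.ae_norm_vel_wlim_sq] with x hC hv
  exact mem_K_of_mem_C_of_norm_sq_eq hC hv

/-! ## `L²` convergence along the subsequence and the `H⁻¹` bound -/

/-- **Fatou**: `∫⁻ ‖w - w_{φ(i)}‖ₑ² ≤ 4^{-i}`. [folklore] -/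
theorem lintegral_enorm_wlim_sub_sq_le (i : ℕ) :
    ∫⁻ x, ‖D.wlim x - D.state (D.sub i) x‖ₑ ^ (2 : ℝ) ≤ ENNReal.ofReal ((1 / 4) ^ i) := by
  have hmeas : ∀ j, AEMeasurable (fun x => ‖D.state (D.sub j) x - D.state (D.sub i) x‖ₑ ^ (2 : ℝ)) volume := fun j =>
    ((((D.state_continuous _).sub (D.state_continuous _)).measurable.enorm.pow_const _)).aemeasurable
  have hlim : ∀ᵐ x, Tendsto (fun j => ‖D.state (D.sub j) x - D.state (D.sub i) x‖ₑ ^ (2 : ℝ)) atTop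
      (𝓝 (‖D.wlim x - D.state (D.sub i) x‖ₑ ^ (2 : ℝ))) := by
    filter_upwards [D.ae_tendsto_wlim] with x hx
    have h1 : Tendsto (fun j => D.state (D.sub j) x - D.state (D.sub i) x) atTop (𝓝 (D.wlim x - D.state (D.sub i) x)) :=
      hx.sub tendsto_const_nhds
    exact ((ENNReal.continuous_rpow_const.tendsto _).comp ((continuous_enorm.tendsto _).comp h1))
  have hb : ∀ j, i ≤ j → ∫⁻ x, ‖D.state (D.sub j) x - D.state (D.sub i) x‖ₑ ^ (2 : ℝ) ≤ ENNReal.ofReal ((1 / 4) ^ i) := by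
    intro j hij
    have hint : Integrable (fun x => ‖D.state (D.sub j) x - D.state (D.sub i) x‖ ^ 2) :=
      (((D.state_continuous _).sub (D.state_continuous _)).norm.pow 2).integrable_unitAddTorus
    have hfeq : (fun x => ‖D.state (D.sub j) x - D.state (D.sub i) x‖ₑ ^ (2 : ℝ)) =
        fun x => ENNReal.ofReal (‖D.state (D.sub j) x - D.state (D.sub i) x‖ ^ 2) := by
      funext x
      rw [ENNReal.rpow_two, ← ofReal_norm, ← ENNReal.ofReal_pow (norm_nonneg _)]
    rw [hfeq, ← ofReal_integral_eq_lintegral_ofReal hint (ae_of_all _ fun x => by positivity)]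
    exact ENNReal.ofReal_le_ofReal (D.integral_sq_sub_lt hij).le
  calc ∫⁻ x, ‖D.wlim x - D.state (D.sub i) x‖ₑ ^ (2 : ℝ)
      = ∫⁻ x, liminf (fun j => ‖D.state (D.sub j) x - D.state (D.sub i) x‖ₑ ^ (2 : ℝ)) atTop :=
        lintegral_congr_ae (hlim.mono fun x hx => hx.liminf_eq.symm)
    _ ≤ liminf (fun j => ∫⁻ x, ‖D.state (D.sub j) x - D.state (D.sub i) x‖ₑ ^ (2 : ℝ)) atTop := lintegral_liminf_le' hmeas
    _ ≤ ENNReal.ofReal ((1 / 4) ^ i) := liminf_le_of_frequently_le' (((eventually_ge_atTop i).mono hb).frequently)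

/-- The limit velocity is integrable (bounded and measurable). [folklore] -/
theorem integrable_vel_wlim : Integrable (fun x => vel (D.wlim x)) volume := by
  refine Integrable.mono' (integrable_const D.R) (continuous_vel.comp_aestronglyMeasurable D.aestronglyMeasurable_wlim) ?_
  filter_upwards [D.ae_norm_wlim_le] with x hx
  exact (norm_vel_le _).trans hx

/-- The limit velocity is in every `L^p`, here `L²`. [folklore] -/
theorem memLp_vel_wlim_sub (i : ℕ) : MemLp (fun x => vel (D.wlim x) - vel (D.state (D.sub i) x)) 2 volume := by
  refine (memLp_top_of_bound ((continuous_vel.comp_aestronglyMeasurable D.aestronglyMeasurable_wlim).sub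
    (continuous_vel.comp (D.state_continuous _)).aestronglyMeasurable) (D.R + D.R) ?_).mono_exponent le_top
  filter_upwards [D.ae_norm_wlim_le] with x hx
  exact (norm_sub_le _ _).trans (add_le_add ((norm_vel_le _).trans hx) ((norm_vel_le _).trans (D.norm_state_le _ x)))

/-- **`‖v - v_{φ(i)}‖_{H⁻¹} ≤ 2^{-i}`** (`H⁻¹ ≤ L²` and Fatou). [folklore] -/
theorem eSobolevNorm_vel_wlim_sub_state_le (i : ℕ) :
    Torus.eSobolevNorm (-1) (EuclideanSpace.complexify ∘ fun x => vel (D.wlim x) - vel (D.state (D.sub i) x)) ≤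
      ENNReal.ofReal ((1 / 2) ^ i) := by
  refine (Torus.eSobolevNorm_mono (show (-1 : ℝ) ≤ 0 by norm_num) _).trans ?_
  rw [Torus.eSobolevNorm_zero_complexify (D.memLp_vel_wlim_sub i),
    eLpNorm_eq_lintegral_rpow_enorm_toReal two_ne_zero ENNReal.ofNat_ne_top]
  simp only [ENNReal.toReal_ofNat]
  have h1 : ∫⁻ x, ‖vel (D.wlim x) - vel (D.state (D.sub i) x)‖ₑ ^ (2 : ℝ) ≤ ENNReal.ofReal ((1 / 4) ^ i) := by
    refine (lintegral_mono fun x => ?_).trans (D.lintegral_enorm_wlim_sub_sq_le i)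
    refine ENNReal.rpow_le_rpow ?_ (by norm_num)
    rw [← vel_sub, ← ofReal_norm, ← ofReal_norm]
    exact ENNReal.ofReal_le_ofReal (norm_vel_le _)
  calc (∫⁻ x, ‖vel (D.wlim x) - vel (D.state (D.sub i) x)‖ₑ ^ (2 : ℝ)) ^ (1 / (2 : ℝ))
      ≤ (ENNReal.ofReal ((1 / 4) ^ i)) ^ (1 / (2 : ℝ)) := ENNReal.rpow_le_rpow h1 (by norm_num)
    _ = ENNReal.ofReal ((1 / 2) ^ i) := by
        rw [ENNReal.ofReal_rpow_of_nonneg (by positivity) (by norm_num)]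
        congr 1
        rw [show ((1 : ℝ) / 4) ^ i = (((1 : ℝ) / 2) ^ i) ^ (2 : ℕ) by rw [← pow_mul, mul_comm, pow_mul]; norm_num,
          ← Real.rpow_natCast, ← Real.rpow_mul (by positivity)]
        norm_num

/-- **The `H⁻¹` bound of the limit**: `‖v - v₀‖_{H⁻¹} ≤ θ`. [cite: ChoffrutSzekelyhidi2014, Thm. 1] -/
theorem eSobolevNorm_vel_wlim_sub_le :
    Torus.eSobolevNorm (-1) (EuclideanSpace.complexify ∘ fun x => vel (D.wlim x) - vel (D.w₀ x)) ≤ ENNReal.ofReal D.θ := by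
  refine ENNReal.le_of_forall_pos_le_add fun ε hε _ => ?_
  obtain ⟨i, hi⟩ := exists_pow_lt_of_lt_one (NNReal.coe_pos.2 hε) (show ((1 : ℝ) / 2) < 1 by norm_num)
  have hsplit : (EuclideanSpace.complexify ∘ fun x => vel (D.wlim x) - vel (D.w₀ x)) =
      (EuclideanSpace.complexify ∘ fun x => vel (D.wlim x) - vel (D.state (D.sub i) x)) +
        (EuclideanSpace.complexify ∘ fun x => vel (D.state (D.sub i) x) - vel (D.w₀ x)) := by
    funext x
    simp only [comp_apply, Pi.add_apply, ← map_add]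
    congr 1; abel
  rw [hsplit]
  have hI1 : Integrable (EuclideanSpace.complexify ∘ fun x => vel (D.wlim x) - vel (D.state (D.sub i) x)) volume :=
    (EuclideanSpace.complexify (ι := d)).toContinuousLinearMap.integrable_comp
      (D.integrable_vel_wlim.sub (continuous_vel.comp (D.state_continuous _)).integrable_unitAddTorus)
  have hI2 : Integrable (EuclideanSpace.complexify ∘ fun x => vel (D.state (D.sub i) x) - vel (D.w₀ x)) volume :=
    (EuclideanSpace.continuous_complexify.comp ((continuous_vel.comp (D.state_continuous _)).sub
      (continuous_vel.comp D.hw₀.continuous))).integrable_unitAddTorus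
  refine (Torus.eSobolevNorm_add_le_holds hI1 hI2).trans ?_
  rw [add_comm]
  refine add_le_add ((D.eSobolevNorm_vel_state_sub_le _).trans (ENNReal.ofReal_le_ofReal (D.sum_eps_le _))) ?_
  refine (D.eSobolevNorm_vel_wlim_sub_state_le i).trans ?_
  rw [← ENNReal.ofReal_coe_nnreal]
  exact ENNReal.ofReal_le_ofReal hi.le

/-! ## The weak identities pass to the limit -/

omit [Fintype d] [DecidableEq d] [Nonempty d] in
/-- A continuous real function on the torus is bounded. [folklore] -/
theorem exists_abs_bound_of_continuous {f : UnitAddTorus d → ℝ} (hf : Continuous f) : ∃ B, 0 ≤ B ∧ ∀ x, |f x| ≤ B := by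
  obtain ⟨B, hB⟩ := (isCompact_range hf).isBounded.exists_norm_le
  exact ⟨max B 0, le_max_right _ _, fun x => (hB _ ⟨x, rfl⟩).trans (le_max_left _ _)⟩

/-- **Dominated convergence for linear observables of the states**:
`∫ Σᵢ (w_{φ(j)})_{cᵢ} aᵢ → ∫ Σᵢ w_{cᵢ} aᵢ` for continuous coefficients `aᵢ`. [folklore] -/
theorem tendsto_integral_sum_coord_mul {ι : Type*} [Fintype ι] (c : ι → Idx d) (a : ι → UnitAddTorus d → ℝ)
    (ha : ∀ i, Continuous (a i)) :
    Tendsto (fun j => ∫ x, ∑ i, D.state (D.sub j) x (c i) * a i x) atTop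
      (𝓝 (∫ x, ∑ i, D.wlim x (c i) * a i x)) := by
  choose B hB0 hB using fun i => exists_abs_bound_of_continuous (ha i)
  have hcoord : ∀ (s : State d) (k : Idx d), |s k| ≤ ‖s‖ := fun s k => by
    simpa using PiLp.norm_apply_le s k
  refine tendsto_integral_of_dominated_convergence (fun _ => ∑ i, D.R * B i) (fun j => ?_) (integrable_const _)
    (fun j => Eventually.of_forall fun x => ?_) ?_
  · exact (continuous_finsetSum _ fun i _ => (((PiLp.continuous_apply 2 (fun _ : Idx d => ℝ) (c i)).comp
      (D.state_continuous _)).mul (ha i))).aestronglyMeasurable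
  · rw [Real.norm_eq_abs]
    refine (Finset.abs_sum_le_sum_abs _ _).trans (Finset.sum_le_sum fun i _ => ?_)
    rw [abs_mul]
    exact mul_le_mul ((hcoord _ _).trans (D.norm_state_le _ x)) (hB i x) (abs_nonneg _) D.R_nonneg
  · filter_upwards [D.ae_tendsto_wlim] with x hx
    exact tendsto_finsetSum _ fun i _ =>
      ((((PiLp.continuous_apply 2 (fun _ : Idx d => ℝ) (c i)).tendsto _).comp hx).mul tendsto_const_nhds)

/-- **Weak `div v = 0` for the limit.** [cite: ChoffrutSzekelyhidi2014, Lemma 2] -/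
theorem wlim_weak_div {θ : UnitAddTorus d → ℝ} (hθ : Torus.IsSmooth θ) :
    ∫ x, ∑ i, vel (D.wlim x) i * Torus.partialDeriv i θ x = 0 := by
  have h := D.tendsto_integral_sum_coord_mul (fun i : d => Sum.inl i) (fun i => Torus.partialDeriv i θ)
    fun i => (hθ.partialDeriv i).continuous
  have h0 : ∀ j, ∫ x, ∑ i, D.state (D.sub j) x (Sum.inl i) * Torus.partialDeriv i θ x = 0 := fun j => by
    simpa only [vel_apply] using (D.state_memX0 (D.sub j)).sub.1 θ hθ
  simp only [h0] at h
  simpa only [vel_apply] using (tendsto_nhds_unique h tendsto_const_nhds)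

/-- **Weak `div u + ∇q = 0` (tested with divergence-free fields) for the limit.** [cite: ChoffrutSzekelyhidi2014, Lemma 2] -/
theorem wlim_weak_str {Φ : UnitAddTorus d → Ed d} (hΦ : Torus.IsSmooth Φ) (hdiv : Torus.IsDivFree Φ) :
    ∫ x, ∑ i, ∑ j, str (D.wlim x) i j * Torus.partialDeriv j (fun y => Φ y i) x = 0 := by
  have h := D.tendsto_integral_sum_coord_mul (fun ij : d × d => Sum.inr ij)
    (fun ij => Torus.partialDeriv ij.2 (fun y => Φ y ij.1)) fun ij => ((hΦ.apply ij.1).partialDeriv ij.2).continuous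
  have h0 : ∀ k, ∫ x, ∑ ij : d × d, D.state (D.sub k) x (Sum.inr ij) * Torus.partialDeriv ij.2 (fun y => Φ y ij.1) x = 0 := by
    intro k
    have := (D.state_memX0 (D.sub k)).sub.2 Φ hΦ hdiv
    simpa only [str_apply, Fintype.sum_prod_type] using this
  simp only [h0] at h
  have hl := tendsto_nhds_unique h tendsto_const_nhds
  simpa only [str_apply, Fintype.sum_prod_type] using hl

end IterData

end StationaryEuler

end Literature.Analysis.FluidPDE
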